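import Summits.QuantumFields.BalabanUV.Beta.SpineRecursiveClosed
import Summits.QuantumFields.BalabanUV.Beta.StepLambdaReflection
import Summits.QuantumFields.BalabanUV.Beta.SpineRootedW2

/-!
# THE FIRST-ORDER SHARP LAWS OF THE UNFOLDED PAIR `(SpureRecAt j, M1At j)` of the (L4-D) W-literal — the `hS`/`hM` inputs of
# `SecondOrderTransport.W2OfK_bref_sharp` / `W2SymOfK_bref_sharp` for the recursive wall family v2.26 (`d + 1 = 4`, odd `Lc`, centred root)
# (β sub-cell, row BETA-an2 = BINDER-OWNERS row D1 OWNER, lineage an2 gen 17; memo `SKELETON-D1-L4.v1` §3)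

HONEST FRAMING (cell charter, verbatim): «discharging BetaPertH makes Balaban's UV stability UNCONDITIONAL — a real
constructive-QFT result; it is NOT the continuum limit and NOT the Clay problem.»  DERIVED cell leaf: no statement of Bałaban's papers is
typed here, no `[cite:]` tag, no `def`, no `Prop` fact; it instantiates no binder of the β-function wall by itself.  NOT D1, NOT `BetaPertH`,
NOT continuum, NOT Clay.

## What is here ([folklore]; everything from the PROVED folded law `SpineRecursiveClosed.hSrC_SrecAt_all` and the PURE-SIGN laws of the
## Lagrange pieces `LambdaPieceReflection.SLam_lamCoeffOf_hessFFAt_reflect` / `StepLambdaReflection.smul_SLam_step_reflect` by subtraction)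

The (L4-D) W-literal `SpineRecursiveW.WrecAt j = W2SymOfK G_j Lc (SpureRecAt j) (M1At j) (T2RecAt j) (M2Of mixFF j)` reads the UNFOLDED first-order
pair: the field table `SpureRecAt j = SrecAt j − (Λ-piece j)` and the multiplier table `M1At j = (cΛ·wM1 j) • hessFFAt`.  The transport theorem
`W2SymOfK_bref_sharp` needs their sharp laws.  Stated here on the DISPLAYED members (so that this file does not wait for the review of the
definitions file `SpineRecursiveW`; there `SpureRecAt_zero_level/_succ` are `rfl` on these displays):
* `sub_bref_of_laws`: the law of a difference of two families from the two laws (pointwise algebra);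
* **`pureZero_bref`** (level `0`): `(cE • wilsonA + cVH • vhSAt ρ_c) κ (bref u) = ε_κ • refK (… + conjV (bhKStepAt 0) (γ 0 • diagK (ctGen α κ u)))`;
* **`pureSucc_bref`** (level `j+1`): the same for `(cE·wE (j+1)) • e3OfK Lc G_j (SrecAt j) + (cVH·wVH (j+1)) • vhSAt ρ_c` against `bhKStepAt (j+1)`,
  contact `γ (j+1) • diagK ctGen` — under `hn : 2·cVH = −cE·Lc⁴`, `hγ`, the locks `hlock` of `SpineRecursiveInductive`; and `…_bcj` forms at the pin
  `(cE, cVH) = (Lc⁴, −Lc⁸/2)`;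
* **`M1At_bref`**: `M1At 3 Lc ρ_c cΛ j μ (bref w) = ε_μ • refK (M1At … j μ w)` — pure sign (`RootedKernelReflection.hessFFAt_reflect`), the `hM` input
  (♯-table = table).
Provenance: β sub-cell, unit beta-an2 gen 17, 2026-08-20 (v1); BY NAME over `SpineRecursiveClosed` (an2 gen 16), an5's `LambdaPieceReflection`,
an2's `StepLambdaReflection`, `SpineRootedW2`; no existing file touched.
-/

open Finset
open scoped BigOperators
open Literature.MathematicalPhysics.QuantumFieldTheory
open Literature.MathematicalPhysics.QuantumFieldTheory.Balaban1983to89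
open Literature.MathematicalPhysics.QuantumFieldTheory.Balaban1983to89.Beta
open ExpKernelCalculus (MKer)
open AffineAveraging (toSite)
open AveragingContoursRooted (ctr ctrOff ctrOff_mem_box)
open AveragingHessianKernelsRooted (vhSAt hessFFAt)
open PolarizationSign (reflSign)
open KernelReflection (refK refK_apply)
open ResolventReflection (bref Φ)
open OneStepResolventKernel (Fib KInv)
open OneStepKernelFamily (KInvStep)
open StepJetData (wilsonA)
open InterLevelTransport (SLam)
open BalabanStepJets (lamCoeffOf)
open BalabanStepJetsSucc (E2 lamCoeffK wE wVH wΛ)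
open RootedKernelReflection (hessFFAt_reflect)
open Summit.QuantumFields.BalabanUV.Beta.ChartConjugation (conjV)
open Summit.QuantumFields.BalabanUV.Beta.AxialDressingRooted (coDressKBmAt)
open Summit.QuantumFields.BalabanUV.Beta.BorderedHessian (bhKStepAt stepScale diagK ctGen)
open Summit.QuantumFields.BalabanUV.Beta.WardLocusRecursive (SrecAt SrecAt_zero SrecAt_succ)
open Summit.QuantumFields.BalabanUV.Beta.E3LevelOneReflection (refK_sub refK_smul)

noncomputable section

namespace Summit.QuantumFields.BalabanUV.Beta.SpineRooted

variable {d N : ℕ}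

/-! ## §1 The law of a difference -/

/-- [folklore] **A LAW WITH CONTACT MINUS A PURE-SIGN LAW IS A LAW WITH THE SAME CONTACT**: if `S κ (bref u) = ε • refK (S κ u + C)` and
`P κ (bref u) = ε • refK (P κ u)`, then `(S − P) κ (bref u) = ε • refK ((S − P) κ u + C)`. -/
theorem sub_bref_of_laws {α : Fin (d + 1)} {S P : Fin (d + 1) → (Fin (d + 1) → ℤ) → MKer (d + 1) (Fib d)}
    {C : Fin (d + 1) → (Fin (d + 1) → ℤ) → MKer (d + 1) (Fib d)}
    (hS : ∀ κ u, S κ (bref α κ u) = reflSign α κ • refK (Φ N α) (S κ u + C κ u))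
    (hP : ∀ κ u, P κ (bref α κ u) = reflSign α κ • refK (Φ N α) (P κ u)) (κ : Fin (d + 1)) (u : Fin (d + 1) → ℤ) :
    S κ (bref α κ u) - P κ (bref α κ u) = reflSign α κ • refK (Φ N α) (S κ u - P κ u + C κ u) := by
  rw [hS, hP, ← smul_sub, ← refK_sub]
  congr 2
  abel

/-! ## §2 The unfolded field tables of the recursive family: the (Sr-conj) law at every level -/

section Pure

variable {Lc : ℕ} [NeZero Lc]

/-- [folklore] The Λ-piece of `SrecAt … 0 = S0NAt` at the centred root obeys the PURE-SIGN law (an5's `SLam_lamCoeffOf_hessFFAt_reflect`, scaled). -/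
theorem lamZero_bref (hLc : Odd Lc) (cΛ : ℝ) (α κ : Fin (d + 1)) (u : Fin (d + 1) → ℤ) :
    cΛ • SLam Lc (lamCoeffOf (KInv (N := Lc) (d := d)) Lc) (fun μ y => hessFFAt (toSite (ctrOff (d + 1) Lc)) Lc μ y) κ (bref α κ u) =
      reflSign α κ • refK (Φ Lc α)
        (cΛ • SLam Lc (lamCoeffOf (KInv (N := Lc) (d := d)) Lc) (fun μ y => hessFFAt (toSite (ctrOff (d + 1) Lc)) Lc μ y) κ u) := by
  have h := SLam_lamCoeffOf_hessFFAt_reflect (d := d) hLc α κ u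
  simp only [AveragingContoursRooted.ctr] at h
  rw [h, refK_smul, smul_comm]

/-- [folklore] **(Sr-conj) OF THE LEVEL-`0` UNFOLDED FIELD TABLE** `cE • wilsonA + cVH • vhSAt ρ_c` (= `SpureRecAt … 0`): the folded law of
`S0NAt` (`hSrC_SrecAt_all … 0`) minus the pure-sign law of its Λ-piece. -/
theorem pureZero_bref (hLc : Odd Lc) (cE cVH cΛ : ℝ) (hn : 2 * cVH = -(cE * (Lc : ℝ) ^ 4)) (γ : ℕ → ℝ)
    (hγ : ∀ j, γ j = cVH * wVH 3 Lc j / (stepScale 3 Lc j * (Lc : ℝ) ^ 4))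
    (hlock : ∀ j, cE * wE 3 Lc (j + 1) * (γ j / (stepScale 3 Lc j * (Lc : ℝ) ^ 4 * wVH 3 Lc (j + 1))) = γ (j + 1))
    (α κ : Fin 4) (u : Fin 4 → ℤ) :
    (fun κ' u' => cE • wilsonA 3 κ' u' + cVH • vhSAt (toSite (ctrOff 4 Lc)) 3 Lc rfl κ' u') κ (bref α κ u) =
      reflSign α κ • refK (Φ Lc α)
        ((fun κ' u' => cE • wilsonA 3 κ' u' + cVH • vhSAt (toSite (ctrOff 4 Lc)) 3 Lc rfl κ' u') κ u +
          conjV (bhKStepAt 3 (toSite (ctrOff 4 Lc)) Lc 0) (γ 0 • diagK (ctGen 3 α Lc κ u))) := by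
  have hS := hSrC_SrecAt_all hLc cE cVH cΛ hn γ hγ hlock 0 α
  have hP := fun κ' u' => lamZero_bref (d := 3) hLc cΛ α κ' u'
  have e : ∀ κ' u', (fun κ' u' => cE • wilsonA 3 κ' u' + cVH • vhSAt (toSite (ctrOff 4 Lc)) 3 Lc rfl κ' u') κ' u' =
      SrecAt 3 Lc (toSite (ctrOff 4 Lc)) cE cVH cΛ 0 κ' u' -
        cΛ • SLam Lc (lamCoeffOf (KInv (N := Lc) (d := 3)) Lc) (fun μ y => hessFFAt (toSite (ctrOff 4 Lc)) Lc μ y) κ' u' := by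
    intro κ' u'
    rw [SrecAt_zero]
    show _ = (cE • wilsonA 3 κ' u' + cVH • vhSAt (toSite (ctrOff 4 Lc)) 3 Lc rfl κ' u' +
      cΛ • SLam Lc (lamCoeffOf (KInv (N := Lc) (d := 3)) Lc) (fun μ y => hessFFAt (toSite (ctrOff 4 Lc)) Lc μ y) κ' u') - _
    rw [add_sub_cancel_right]
  rw [e, e]
  exact sub_bref_of_laws (S := SrecAt 3 Lc (toSite (ctrOff 4 Lc)) cE cVH cΛ 0)
    (P := fun κ' u' => cΛ • SLam Lc (lamCoeffOf (KInv (N := Lc) (d := 3)) Lc) (fun μ y => hessFFAt (toSite (ctrOff 4 Lc)) Lc μ y) κ' u')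
    hS hP κ u

/-- [folklore] **(Sr-conj) OF THE LEVEL-`(j+1)` UNFOLDED FIELD TABLE** `(cE·wE (j+1)) • e3OfK Lc G_j (SrecAt j) + (cVH·wVH (j+1)) • vhSAt ρ_c`
(= `SpureRecAt … (j+1)`): the folded law of `SrecAt (j+1)` minus the pure-sign law of its Λ-piece (`smul_SLam_step_reflect (j+1)`). -/
theorem pureSucc_bref (hLc : Odd Lc) (cE cVH cΛ : ℝ) (hn : 2 * cVH = -(cE * (Lc : ℝ) ^ 4)) (γ : ℕ → ℝ)
    (hγ : ∀ j, γ j = cVH * wVH 3 Lc j / (stepScale 3 Lc j * (Lc : ℝ) ^ 4))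
    (hlock : ∀ j, cE * wE 3 Lc (j + 1) * (γ j / (stepScale 3 Lc j * (Lc : ℝ) ^ 4 * wVH 3 Lc (j + 1))) = γ (j + 1))
    (j : ℕ) (α κ : Fin 4) (u : Fin 4 → ℤ) :
    (fun κ' u' => (cE * wE 3 Lc (j + 1)) • e3OfK Lc (coDressKBmAt (toSite (ctrOff 4 Lc)) Lc (KInvStep (d := 3) Lc j))
        (SrecAt 3 Lc (toSite (ctrOff 4 Lc)) cE cVH cΛ j) κ' u' + (cVH * wVH 3 Lc (j + 1)) • vhSAt (toSite (ctrOff 4 Lc)) 3 Lc rfl κ' u')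
        κ (bref α κ u) =
      reflSign α κ • refK (Φ Lc α)
        ((fun κ' u' => (cE * wE 3 Lc (j + 1)) • e3OfK Lc (coDressKBmAt (toSite (ctrOff 4 Lc)) Lc (KInvStep (d := 3) Lc j))
            (SrecAt 3 Lc (toSite (ctrOff 4 Lc)) cE cVH cΛ j) κ' u' + (cVH * wVH 3 Lc (j + 1)) • vhSAt (toSite (ctrOff 4 Lc)) 3 Lc rfl κ' u') κ u +
          conjV (bhKStepAt 3 (toSite (ctrOff 4 Lc)) Lc (j + 1)) (γ (j + 1) • diagK (ctGen 3 α Lc κ u))) := by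
  have hS := hSrC_SrecAt_all hLc cE cVH cΛ hn γ hγ hlock (j + 1) α
  have hP : ∀ (κ' : Fin 4) (u' : Fin 4 → ℤ),
      ((cΛ * wΛ 3 Lc (j + 1)) • SLam Lc (lamCoeffK (KInvStep (d := 3) Lc (j + 1)) (E2 3 Lc (j + 1)) Lc)
          (fun μ y => hessFFAt (toSite (ctrOff 4 Lc)) Lc μ y) κ' (bref α κ' u')) =
        reflSign α κ' • refK (Φ Lc α) ((cΛ * wΛ 3 Lc (j + 1)) •
          SLam Lc (lamCoeffK (KInvStep (d := 3) Lc (j + 1)) (E2 3 Lc (j + 1)) Lc) (fun μ y => hessFFAt (toSite (ctrOff 4 Lc)) Lc μ y) κ' u') := by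
    intro κ' u'
    have h := smul_SLam_step_reflect (d := 3) hLc cΛ (j + 1) α κ' u'
    simp only [AveragingContoursRooted.ctr] at h
    exact h
  have e : ∀ κ' u', (fun κ' u' => (cE * wE 3 Lc (j + 1)) • e3OfK Lc (coDressKBmAt (toSite (ctrOff 4 Lc)) Lc (KInvStep (d := 3) Lc j))
        (SrecAt 3 Lc (toSite (ctrOff 4 Lc)) cE cVH cΛ j) κ' u' + (cVH * wVH 3 Lc (j + 1)) • vhSAt (toSite (ctrOff 4 Lc)) 3 Lc rfl κ' u') κ' u' =
      SrecAt 3 Lc (toSite (ctrOff 4 Lc)) cE cVH cΛ (j + 1) κ' u' -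
        (cΛ * wΛ 3 Lc (j + 1)) • SLam Lc (lamCoeffK (KInvStep (d := 3) Lc (j + 1)) (E2 3 Lc (j + 1)) Lc)
          (fun μ y => hessFFAt (toSite (ctrOff 4 Lc)) Lc μ y) κ' u' := by
    intro κ' u'
    rw [SrecAt_succ]
    show _ = ((cE * wE 3 Lc (j + 1)) • e3OfK Lc (coDressKBmAt (toSite (ctrOff 4 Lc)) Lc (KInvStep (d := 3) Lc j))
        (SrecAt 3 Lc (toSite (ctrOff 4 Lc)) cE cVH cΛ j) κ' u' + (cVH * wVH 3 Lc (j + 1)) • vhSAt (toSite (ctrOff 4 Lc)) 3 Lc rfl κ' u' +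
      (cΛ * wΛ 3 Lc (j + 1)) • SLam Lc (lamCoeffK (KInvStep (d := 3) Lc (j + 1)) (E2 3 Lc (j + 1)) Lc)
        (fun μ y => hessFFAt (toSite (ctrOff 4 Lc)) Lc μ y) κ' u') - _
    rw [add_sub_cancel_right]
  rw [e, e]
  exact sub_bref_of_laws (S := SrecAt 3 Lc (toSite (ctrOff 4 Lc)) cE cVH cΛ (j + 1))
    (P := fun κ' u' => (cΛ * wΛ 3 Lc (j + 1)) • SLam Lc (lamCoeffK (KInvStep (d := 3) Lc (j + 1)) (E2 3 Lc (j + 1)) Lc)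
      (fun μ y => hessFFAt (toSite (ctrOff 4 Lc)) Lc μ y) κ' u') hS hP κ u

omit [NeZero Lc] in
/-- [folklore] **THE `hM` INPUT IS PURE SIGN**: `M1At 3 Lc ρ_c cΛ j μ (bref w) = ε_μ • refK (Φ Lc α) (M1At … j μ w)` (an1's `hessFFAt_reflect`, scaled);
generic `d`, odd `Lc`, centred root. -/
theorem M1At_bref (hLc : Odd Lc) (cΛ : ℝ) (j : ℕ) (α μ : Fin (d + 1)) (w : Fin (d + 1) → ℤ) :
    M1At d Lc (toSite (ctrOff (d + 1) Lc)) cΛ j μ (bref α μ w) = reflSign α μ • refK (Φ Lc α) (M1At d Lc (toSite (ctrOff (d + 1) Lc)) cΛ j μ w) := by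
  have h := hessFFAt_reflect (n := d) hLc Lc α μ w
  simp only [AveragingContoursRooted.ctr] at h
  show (cΛ * BalabanStepW2.wM1 d Lc j) • hessFFAt (toSite (ctrOff (d + 1) Lc)) Lc μ (bref α μ w) =
    reflSign α μ • refK (Φ Lc α) ((cΛ * BalabanStepW2.wM1 d Lc j) • hessFFAt (toSite (ctrOff (d + 1) Lc)) Lc μ w)
  rw [h, refK_smul, smul_comm]

end Pure

end Summit.QuantumFields.BalabanUV.Beta.SpineRooted

end
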